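import Summits.ResolutionOfSingularities.ResolutionOfSingularities.Theorems.MarkedTransferCampaignW46TameRegime
import Literature.AlgebraicGeometry.Resolution.KollarGoingUpTame
import Literature.AlgebraicGeometry.Resolution.MaximalContactConeCriterion
import Literature.AlgebraicGeometry.Resolution.CoefficientIdealFactorialOrder
import HarnessLib

/-!
# [OURS · L1 W4.6, rung (iv) «large characteristic», LEVEL 1] The dimension-induction step of the characteristic-zero
# proof runs for the TYPED procedure in regime (iv) — and its honest threshold one level down is `b!`, not `b`
# (cell res-hironaka, LADDER-RESOLUTION rung L, D-0089; slot W4.6, seat res-L1-s46-pv-7; host route MarkedTransfer,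
# `--supports stmt-ResolutionOfSingularities-16155 --as helper`)

HONEST FRAMING. Nothing here is a statement of H. Hironaka's manuscript (2017-03-23, [Hironaka2017]) and nothing here
asserts that any statement of it holds. OURS corollaries, over the shared typed-procedure module
`MarkedTransferCampaignW46TypedProcedure` (res-L1-type-o1: `CampaignW46.Regime.charGT`; typed CANDIDATE carriers
`AmbientDatum`, `IdealExponent`, `IdealExponent.sing` used as definitions), of the TREE's Kollár / BGMW layer in its
tame range — this seat's Literature files `KollarMaximalContactTame.lean` (p525015), `MaximalContactConeCriterion.lean`
(p526336), `KollarGoingUpTame.lean` (p527708), `CoefficientIdealFactorialOrder.lean`. No premise of the manuscript, no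
FACT-LIST premise. AI review is weaker than expert review. No `sorry`, no new definition; axioms standard.

## What this file pins (the seat's target: «proof by reduction to the characteristic-zero-like regime; find the
## honest `C` … prior V5 «wild data reappear at level 1 via `b!`» bounds it»)

For a state `(A, E)`, `E = (J, b)`, of the typed procedure over a PERFECT field `K` of characteristic `p`, in regime
(iv) := `Regime.charGT n (fun _ b ↦ b)` («`b < p`»), with `1 ≤ b` and `J` of maximal order `b`:

* `goingUp_nhd_of_charGT` — **Kollár's 3.104 Step 2.2 at the typed state**: every point has an open neighbourhood
  `U` and a maximal-contact hypersurface ideal `H` on `U` (regular, `Sing(E) ∩ U ⊆ V(H)`, `Kollar2007.IsMaxContact`)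
  such that EVERY blow-up sequence on the regular hypersurface `V(H)` (dimension one less) resolving the restricted
  coefficient marked ideal `(V(H), 𝒞(J|_U, b)|_{V(H)}, ∅, b!)` pushes forward to a RESOLUTION of `(U, J|_U, ∅, b)`
  (tree `CentreSeq.IsResolutionOf`: admissible smooth blow-up sequence emptying the order-`≥ b` locus — the typed
  `Sing` of the successive transforms, `TameMaximalContact.sing_eq_support`). «Reduction to the characteristic-zero-like
  regime», literally: the characteristic-zero dimension induction is available for `E` in regime (iv);
* `exists_hasseDeriv_ne_zero_of_mem_initialForms` — **no wild point in regime (iv)**: at every point `ξ` (local ring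
  of characteristic `p`, the typed rows' binder) every non-zero initial form `G ∈ cl_b(J_ξ)` has a non-zero LINEAR
  Hasse–Schmidt derivative `D^{(B)} G`, `|B| + 1 = b` (the host thesis' «wild point» — all initial forms in
  `k[y_1^p, …, y_n^p]` — cannot occur: `p ∤ b`);
* `nextLevel_not_tame_of_le_factorial` — **the honest threshold ONE LEVEL DOWN is `b!`**: if moreover `p ≤ b!` (the
  state is in regime (iv) but NOT in `Regime.charGT n (fun _ b ↦ b !)`, `not_charGT_factorial_iff`), then at every
  point of `V(H)` over `Sing(E)` the next-level ideal `𝒞(J|_U)·𝒪_{V(H)}` has order `≥ p`: the tame hypothesis under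
  which the tree's Kollár engine runs (orders `< p`) fails for the level-1 data everywhere on `Sing(E) ∩ V(H)` — the
  prior's V5 «wild data reappear at level 1 via `b!`» as a theorem about the derivation-based engine; the window
  `b < p ≤ b!` is non-empty for every `b ≥ 3` (`exists_prime_gt_le_factorial`, Bertrand).

So the honest `C` of the «large `p`» rung, for the tree's characteristic-zero engine: level 0 (tangent cone, maximal
contact, going up) needs exactly `p > b` (gens 2–5, sharp); continuing the induction tamely at level 1 needs `p >`
(orders of the coefficient ideal on the contact hypersurface) `≥ b!`; nothing at level 0 bounds those orders.

## References (context; nothing is cited as a premise)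

* J. Kollár, *Lectures on Resolution of Singularities* (2007), Thm. 3.80, Cor. 3.85, 3.104 Step 2.2, §2.5
  («characteristic `> 3!`»). [cite: Kollar2007, 3.104 Step 2.2]
* E. Bierstone, D. Grigoriev, P. Milman, J. Włodarczyk (2011), Lemma 3.9.4, Thm. 8.0.4.
  [cite: BierstoneGrigorievMilmanWlodarczyk2011, Thm. 8.0.4]
-/

noncomputable section

set_option linter.dupNamespace false -- mandated namespace of this single-conjunct summit

open CategoryTheory AlgebraicGeometry TopologicalSpace IsLocalRing

namespace Summit.ResolutionOfSingularities.ResolutionOfSingularities.Theorems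
namespace CampaignW46
namespace TameInduction

open MvPolynomial
open Literature.AlgebraicGeometry.Resolution
open Literature.AlgebraicGeometry.Hironaka2017.S02Preliminaries

universe u

variable {n : ℕ} {p : ℕ} [Fact p.Prime] {K : Type u} [Field K] [CharP K p]

/-! ## Going up: the dimension induction of characteristic zero, in regime (iv) -/

/-- [OURS · L1 W4.6 (iv); NOT a statement of the manuscript] **Kollár's induction step (3.104 Step 2.2: maximal
contact + going up) for a typed state in regime (iv).** For `(A, E)`, `E = (J, b)`, over a perfect field of
characteristic `p`, `b < p` (`Regime.charGT n (fun _ b ↦ b)`), `1 ≤ b`, `ord_ξ J ≤ b` everywhere: every `ξ` has an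
open `U ∋ ξ` and an ideal sheaf `H` on `U` of a regular hypersurface with `Sing(E) ∩ U ⊆ V(H)`, which is a hypersurface
of maximal contact for `(J|_U, b)` (`Kollar2007.IsMaxContact`), and such that every blow-up sequence `t` on `V(H)`
resolving the restricted coefficient marked ideal `(V(H), 𝒞(J|_U, b)|_{V(H)}, ∅, b!)` pushes forward to a resolution
of `(U, J|_U, ∅, b)`. Instance of this seat's `Kollar2007.exists_maxContact_goingUp_nhd_of_char`.
[cite: Kollar2007, 3.104 Step 2.2, Cor. 3.85, Thm. 3.80] -/
theorem goingUp_nhd_of_charGT [PerfectField K] (A : AmbientDatum p K) (E : IdealExponent A.Z)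
    (hE : Regime.charGT (p := p) (K := K) n (fun _ b => b) A E) (hb : 1 ≤ E.b)
    (hmax : ∀ ξ : A.Z, idealOrder E.J ξ ≤ E.b) (ξ : A.Z) :
    letI : A.Z.Over (Spec (.of K)) := ⟨A.hom⟩
    ∃ (U : A.Z.Opens) (_ : ξ ∈ U) (H : (U : Scheme.{u}).IdealSheafData),
      (∀ y ∈ H.support, ∃ v : (U : Scheme.{u}).presheaf.stalk y,
          stalkIdeal H y = Ideal.span {v} ∧ v ∉ (maximalIdeal ((U : Scheme.{u}).presheaf.stalk y)) ^ 2) ∧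
        (∀ y : (U : Scheme.{u}), y.1 ∈ E.sing → y ∈ H.support) ∧
        Kollar2007.IsMaxContact (E.J.comap U.ι) E.b H ∧
        ∀ (_ : DecidableEq (U : Scheme.{u}).IdealSheafData) (t : CentreSeq H.subscheme),
          t.IsResolutionOf
              ((⟨E.J.comap U.ι, [], E.b⟩ : MarkedIdeal (U : Scheme.{u})).coeffRestrict
                (overHom K (U : Scheme.{u})) H) →
            (t.pushforward H.subschemeι).IsResolutionOf ⟨E.J.comap U.ι, [], E.b⟩ := by
  letI : A.Z.Over (Spec (.of K)) := ⟨A.hom⟩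
  haveI : Smooth (A.Z ↘ Spec (.of K)) := A.smooth
  have hbp : E.b < p := hE
  obtain ⟨U, hξU, H, -, hreg, hsub, hmc, hup⟩ :=
    Kollar2007.exists_maxContact_goingUp_nhd_of_char K A.Z p E.J hb (Or.inr hbp) hmax ξ
  refine ⟨U, hξU, H, hreg, fun y hy => hsub ?_, hmc, hup⟩
  rw [MarkedIdeal.support_comap_of_isOpenImmersion]
  exact hy

/-! ## No wild point in regime (iv) -/

/-- [OURS · L1 W4.6 (iv); NOT a statement of the manuscript] **In regime (iv) no point is wild.** For `(A, E)` in
`Regime.charGT n (fun _ b ↦ b)` with `1 ≤ b`, a point `ξ` whose local ring has characteristic `p` and elements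
`c_1, …, c_d ∈ 𝒪_{Z,ξ}`: every non-zero initial form `G ∈ cl_b(J_ξ)` (tree `initialForms`) has a non-zero
Hasse–Schmidt derivative `D^{(B)} G` with `|B| + 1 = b` — a non-zero LINEAR form (this seat's
`exists_hasseDeriv_ne_zero_of_not_dvd`: `p ∤ b`), i.e. a cone-level maximal-contact coordinate; the host thesis'
«wild point» (all degree-`b` initial forms in `k[y_1^p, …, y_n^p]`) does not occur. [cite: Kollar2007, Aside 3.57] -/
theorem exists_hasseDeriv_ne_zero_of_mem_initialForms (A : AmbientDatum p K) (E : IdealExponent A.Z)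
    (hE : Regime.charGT (p := p) (K := K) n (fun _ b => b) A E) (hb : 1 ≤ E.b) (ξ : A.Z)
    (hp : CharP (A.Z.presheaf.stalk ξ) p) {d : ℕ} (c : Fin d → A.Z.presheaf.stalk ξ)
    {G : MvPolynomial (Fin d) (ResidueField (A.Z.presheaf.stalk ξ))}
    (hG : G ∈ initialForms c (stalkIdeal E.J ξ) E.b) (hG0 : G ≠ 0) :
    ∃ B : Fin d →₀ ℕ, B.degree + 1 = E.b ∧ hasseDeriv (ResidueField (A.Z.presheaf.stalk ξ)) B G ≠ 0 := by
  haveI := hp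
  haveI := TameRegime.charP_residueField (R := A.Z.presheaf.stalk ξ) p
  have hbp : E.b < p := hE
  exact exists_hasseDeriv_ne_zero_of_not_dvd p (isHomogeneous_of_mem_initialForms c hG) hG0
    (Nat.not_dvd_of_pos_of_lt hb hbp)

/-! ## The honest threshold one level down: `b!` -/

/-- [OURS · L1 W4.6 (iv)] The factorial regime `Regime.charGT n (fun _ b ↦ b !)` («`p > b!`», the prior's V5
threshold) fails at `(A, E)` iff `p ≤ b!` (unfolding). [folklore] -/
theorem not_charGT_factorial_iff (A : AmbientDatum p K) (E : IdealExponent A.Z) :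
    ¬ Regime.charGT (p := p) (K := K) n (fun _ b => b.factorial) A E ↔ p ≤ E.b.factorial :=
  not_lt

/-- [OURS · L1 W4.6 (iv); NOT a statement of the manuscript] **«Wild data reappear at level 1 via `b!`» as a
theorem.** For `(A, E)`, `E = (J, b)`, over a perfect field of characteristic `p` with `b ≤ p ≤ b!` (in regime (iv)
whenever `b < p`, but outside `Regime.charGT n (fun _ b ↦ b !)`), and ANY ideal sheaf `H` on `Z` of a regular
hypersurface `S = V(H)` (order-one stalk generators; e.g. a maximal-contact hypersurface): at every point `s ∈ S` over
`Sing(E)` the next-level ideal of the characteristic-zero induction, `𝒞(J)·𝒪_S` (restricted coefficient ideal, marking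
`b!`), has order `≥ p` — `¬ ord_s < p`: the tame hypothesis «orders `< p`» of the tree's Kollár engine fails for the
level-1 data at every such point (this seat's `MarkedIdeal.not_idealOrder_coeff_comap_lt_of_le_factorial`).
[cite: BierstoneGrigorievMilmanWlodarczyk2011, Thm. 8.0.4, Lemma 3.9.4 (2)] [cite: Kollar2007, §2.5 (p. 81)] -/
theorem nextLevel_not_tame_of_le_factorial [PerfectField K] (A : AmbientDatum p K) (E : IdealExponent A.Z)
    (hbp : E.b ≤ p) (hpf : p ≤ E.b.factorial) {H : A.Z.IdealSheafData}
    (hH : ∀ x ∈ H.support, ∃ u : A.Z.presheaf.stalk x,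
      stalkIdeal H x = Ideal.span {u} ∧ u ∉ maximalIdeal (A.Z.presheaf.stalk x) ^ 2)
    {s : H.subscheme} (hs : (H.subschemeι s : A.Z) ∈ E.sing) :
    letI : A.Z.Over (Spec (.of K)) := ⟨A.hom⟩
    ¬ idealOrder (((⟨E.J, [], E.b⟩ : MarkedIdeal A.Z).coeff (overHom K A.Z)).comap H.subschemeι).ideal s < p := by
  letI : A.Z.Over (Spec (.of K)) := ⟨A.hom⟩
  haveI : Smooth (A.Z ↘ Spec (.of K)) := A.smooth
  exact MarkedIdeal.not_idealOrder_coeff_comap_lt_of_le_factorial K A.Z p ⟨E.J, [], E.b⟩ hbp hpf hH hs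

/-- [OURS · L1 W4.6 (iv)] The window `b < p ≤ b!` of the previous theorem is non-empty for every order `b ≥ 3`
(Bertrand; this seat's `exists_prime_gt_le_factorial`): regime (iv) at level 0 never implies the factorial regime.
[cite: Kollar2007, §2.5 (p. 81)] -/
theorem exists_prime_in_factorial_window {b : ℕ} (hb : 3 ≤ b) : ∃ q : ℕ, q.Prime ∧ b < q ∧ q ≤ b.factorial :=
  exists_prime_gt_le_factorial hb

end TameInduction
end CampaignW46
end Summit.ResolutionOfSingularities.ResolutionOfSingularities.Theorems

end
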